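import Summits.Ventures.PercRepro.HyperplaneKeyUpward

/-!
# PercRepro — THE UPWARD KEY AT EVERY LEVEL: THE FORMULA INSTANCES AT LEVELS `5 … 9` (`f = 19, 39, 79, 159, 319, 639`) AND AT EVERY `q` (`f(q) ≤ 2^q − 1`) — `c025_core_<level>_upward_key` / `…_upward_key_two` / `c025_core_upward_key_all` (p1, gen 44; an S3 / S4 feeder — p8 owns SUBCLAIM-S3, p9 SUBCLAIM-S4; no window claim here)

See HyperplaneKeyUpward (the key) and proofs/P1-HYPKEY.md §14. Coloops are not excluded; nothing is claimed below the thresholds.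
Axioms: standard.
-/

open scoped Matroid

namespace PercRepro

namespace HypKey

open Set

variable {α : Type}

/-- **THE UPWARD KEY AT EVERY LEVEL**: on the `e`-free core every rank-`≤ q` set has `≤ 2^q − 1` points, so `q + 1 < p`,
`2^q − 1 ≤ n` and `(q+1)·Φ(p, q) ≤ n − (2^q − 1)` give `RLS M p q`. -/
theorem c025_core_upward_key_all (M : Matroid α) [M.Finite] (p q : ℕ) (hqp : q + 1 < p) (hF : 2 ^ q - 1 ≤ M.E.ncard)
    (hkey : ((q + 1 : ℕ) : ℚ) * phiK p q ≤ (M.E.ncard : ℚ) - ((2 ^ q - 1 : ℕ) : ℚ))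
    (hfree : ∀ e ∈ M.E, ∃ A ⊆ M.E \ {e}, e ∉ M.closure A ∧ e ∉ M.closure ((M.E \ {e}) \ A)) :
    ThmN.RLS M p q :=
  rls_of_upward_key M p q (2 ^ q - 1)
    (fun X hX h => by
      have := ThmN.ncard_add_one_le_two_pow_of_eRk_le M (ThmN.not_isLoop_of_free M hfree) hfree q X hX h
      omega)
    hqp hF hkey


/-- **THE UPWARD KEY AT LEVEL `5` (one layer)**: `6 < p`, `19 ≤ n` and `6·Φ(p, 5) ≤ n − 19` give `RLS M p 5` on the `e`-free
core (`f(5) = 19`). -/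
theorem c025_core_five_upward_key (M : Matroid α) [M.Finite] (p : ℕ) (hqp : 6 < p) (hF : 19 ≤ M.E.ncard)
    (hkey : (6 : ℚ) * phiK p 5 ≤ (M.E.ncard : ℚ) - 19)
    (hfree : ∀ e ∈ M.E, ∃ A ⊆ M.E \ {e}, e ∉ M.closure A ∧ e ∉ M.closure ((M.E \ {e}) \ A)) :
    ThmN.RLS M p 5 :=
  rls_of_upward_key M p 5 19 (fun X hX h => ThmN.ncard_le_nineteen_of_eRk_le_five_of_free M hfree hX (by simpa using h)) hqp hF (by exact_mod_cast hkey)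


/-- **THE UPWARD KEY AT LEVEL `5` (two layers)**: `7 < p`, `39 ≤ n` and `42·Φ(p, 5) ≤ (n − 19)·(7 + (n − 39))`
give `RLS M p 5` (`f(5) = 19`, `f(6) = 39`). -/
theorem c025_core_five_upward_key_two (M : Matroid α) [M.Finite] (p : ℕ) (hqp : 7 < p) (hF' : 39 ≤ M.E.ncard)
    (hkey : (42 : ℚ) * phiK p 5 ≤ ((M.E.ncard : ℚ) - 19) * (7 + ((M.E.ncard : ℚ) - 39)))
    (hfree : ∀ e ∈ M.E, ∃ A ⊆ M.E \ {e}, e ∉ M.closure A ∧ e ∉ M.closure ((M.E \ {e}) \ A)) :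
    ThmN.RLS M p 5 :=
  rls_of_upward_key_two M p 5 19 39 (fun X hX h => ThmN.ncard_le_nineteen_of_eRk_le_five_of_free M hfree hX (by simpa using h)) (fun X hX h => ThmN.ncard_le_thirtynine_of_eRk_le_six_of_free M hfree hX (by simpa using h)) hqp (by omega) hF'
    (by push_cast; linarith [hkey])


/-- **THE UPWARD KEY AT LEVEL `6` (one layer)**: `7 < p`, `39 ≤ n` and `7·Φ(p, 6) ≤ n − 39` give `RLS M p 6` on the `e`-free
core (`f(6) = 39`). -/
theorem c025_core_six_upward_key (M : Matroid α) [M.Finite] (p : ℕ) (hqp : 7 < p) (hF : 39 ≤ M.E.ncard)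
    (hkey : (7 : ℚ) * phiK p 6 ≤ (M.E.ncard : ℚ) - 39)
    (hfree : ∀ e ∈ M.E, ∃ A ⊆ M.E \ {e}, e ∉ M.closure A ∧ e ∉ M.closure ((M.E \ {e}) \ A)) :
    ThmN.RLS M p 6 :=
  rls_of_upward_key M p 6 39 (fun X hX h => ThmN.ncard_le_thirtynine_of_eRk_le_six_of_free M hfree hX (by simpa using h)) hqp hF (by exact_mod_cast hkey)


/-- **THE UPWARD KEY AT LEVEL `6` (two layers)**: `8 < p`, `79 ≤ n` and `56·Φ(p, 6) ≤ (n − 39)·(8 + (n − 79))`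
give `RLS M p 6` (`f(6) = 39`, `f(7) = 79`). -/
theorem c025_core_six_upward_key_two (M : Matroid α) [M.Finite] (p : ℕ) (hqp : 8 < p) (hF' : 79 ≤ M.E.ncard)
    (hkey : (56 : ℚ) * phiK p 6 ≤ ((M.E.ncard : ℚ) - 39) * (8 + ((M.E.ncard : ℚ) - 79)))
    (hfree : ∀ e ∈ M.E, ∃ A ⊆ M.E \ {e}, e ∉ M.closure A ∧ e ∉ M.closure ((M.E \ {e}) \ A)) :
    ThmN.RLS M p 6 :=
  rls_of_upward_key_two M p 6 39 79 (fun X hX h => ThmN.ncard_le_thirtynine_of_eRk_le_six_of_free M hfree hX (by simpa using h)) (fun X hX h => ThmN.ncard_le_seventynine_of_eRk_le_seven_of_free M hfree X hX (by simpa using h)) hqp (by omega) hF'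
    (by push_cast; linarith [hkey])


/-- **THE UPWARD KEY AT LEVEL `7` (one layer)**: `8 < p`, `79 ≤ n` and `8·Φ(p, 7) ≤ n − 79` give `RLS M p 7` on the `e`-free
core (`f(7) = 79`). -/
theorem c025_core_seven_upward_key (M : Matroid α) [M.Finite] (p : ℕ) (hqp : 8 < p) (hF : 79 ≤ M.E.ncard)
    (hkey : (8 : ℚ) * phiK p 7 ≤ (M.E.ncard : ℚ) - 79)
    (hfree : ∀ e ∈ M.E, ∃ A ⊆ M.E \ {e}, e ∉ M.closure A ∧ e ∉ M.closure ((M.E \ {e}) \ A)) :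
    ThmN.RLS M p 7 :=
  rls_of_upward_key M p 7 79 (fun X hX h => ThmN.ncard_le_seventynine_of_eRk_le_seven_of_free M hfree X hX (by simpa using h)) hqp hF (by exact_mod_cast hkey)


/-- **THE UPWARD KEY AT LEVEL `7` (two layers)**: `9 < p`, `159 ≤ n` and `72·Φ(p, 7) ≤ (n − 79)·(9 + (n − 159))`
give `RLS M p 7` (`f(7) = 79`, `f(8) = 159`). -/
theorem c025_core_seven_upward_key_two (M : Matroid α) [M.Finite] (p : ℕ) (hqp : 9 < p) (hF' : 159 ≤ M.E.ncard)
    (hkey : (72 : ℚ) * phiK p 7 ≤ ((M.E.ncard : ℚ) - 79) * (9 + ((M.E.ncard : ℚ) - 159)))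
    (hfree : ∀ e ∈ M.E, ∃ A ⊆ M.E \ {e}, e ∉ M.closure A ∧ e ∉ M.closure ((M.E \ {e}) \ A)) :
    ThmN.RLS M p 7 :=
  rls_of_upward_key_two M p 7 79 159 (fun X hX h => ThmN.ncard_le_seventynine_of_eRk_le_seven_of_free M hfree X hX (by simpa using h)) (fun X hX h => ThmN.ncard_le_one_fifty_nine_of_eRk_le_eight_of_free M hfree X hX (by simpa using h)) hqp (by omega) hF'
    (by push_cast; linarith [hkey])


/-- **THE UPWARD KEY AT LEVEL `8` (one layer)**: `9 < p`, `159 ≤ n` and `9·Φ(p, 8) ≤ n − 159` give `RLS M p 8` on the `e`-free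
core (`f(8) = 159`). -/
theorem c025_core_eight_upward_key (M : Matroid α) [M.Finite] (p : ℕ) (hqp : 9 < p) (hF : 159 ≤ M.E.ncard)
    (hkey : (9 : ℚ) * phiK p 8 ≤ (M.E.ncard : ℚ) - 159)
    (hfree : ∀ e ∈ M.E, ∃ A ⊆ M.E \ {e}, e ∉ M.closure A ∧ e ∉ M.closure ((M.E \ {e}) \ A)) :
    ThmN.RLS M p 8 :=
  rls_of_upward_key M p 8 159 (fun X hX h => ThmN.ncard_le_one_fifty_nine_of_eRk_le_eight_of_free M hfree X hX (by simpa using h)) hqp hF (by exact_mod_cast hkey)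


/-- **THE UPWARD KEY AT LEVEL `8` (two layers)**: `10 < p`, `319 ≤ n` and `90·Φ(p, 8) ≤ (n − 159)·(10 + (n − 319))`
give `RLS M p 8` (`f(8) = 159`, `f(9) = 319`). -/
theorem c025_core_eight_upward_key_two (M : Matroid α) [M.Finite] (p : ℕ) (hqp : 10 < p) (hF' : 319 ≤ M.E.ncard)
    (hkey : (90 : ℚ) * phiK p 8 ≤ ((M.E.ncard : ℚ) - 159) * (10 + ((M.E.ncard : ℚ) - 319)))
    (hfree : ∀ e ∈ M.E, ∃ A ⊆ M.E \ {e}, e ∉ M.closure A ∧ e ∉ M.closure ((M.E \ {e}) \ A)) :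
    ThmN.RLS M p 8 :=
  rls_of_upward_key_two M p 8 159 319 (fun X hX h => ThmN.ncard_le_one_fifty_nine_of_eRk_le_eight_of_free M hfree X hX (by simpa using h)) (fun X hX h => ThmN.ncard_le_three_nineteen_of_eRk_le_nine_of_free M hfree X hX (by simpa using h)) hqp (by omega) hF'
    (by push_cast; linarith [hkey])


/-- **THE UPWARD KEY AT LEVEL `9` (one layer)**: `10 < p`, `319 ≤ n` and `10·Φ(p, 9) ≤ n − 319` give `RLS M p 9` on the `e`-free
core (`f(9) = 319`). -/
theorem c025_core_nine_upward_key (M : Matroid α) [M.Finite] (p : ℕ) (hqp : 10 < p) (hF : 319 ≤ M.E.ncard)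
    (hkey : (10 : ℚ) * phiK p 9 ≤ (M.E.ncard : ℚ) - 319)
    (hfree : ∀ e ∈ M.E, ∃ A ⊆ M.E \ {e}, e ∉ M.closure A ∧ e ∉ M.closure ((M.E \ {e}) \ A)) :
    ThmN.RLS M p 9 :=
  rls_of_upward_key M p 9 319 (fun X hX h => ThmN.ncard_le_three_nineteen_of_eRk_le_nine_of_free M hfree X hX (by simpa using h)) hqp hF (by exact_mod_cast hkey)


/-- **THE UPWARD KEY AT LEVEL `9` (two layers)**: `11 < p`, `639 ≤ n` and `110·Φ(p, 9) ≤ (n − 319)·(11 + (n − 639))`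
give `RLS M p 9` (`f(9) = 319`, `f(10) = 639`). -/
theorem c025_core_nine_upward_key_two (M : Matroid α) [M.Finite] (p : ℕ) (hqp : 11 < p) (hF' : 639 ≤ M.E.ncard)
    (hkey : (110 : ℚ) * phiK p 9 ≤ ((M.E.ncard : ℚ) - 319) * (11 + ((M.E.ncard : ℚ) - 639)))
    (hfree : ∀ e ∈ M.E, ∃ A ⊆ M.E \ {e}, e ∉ M.closure A ∧ e ∉ M.closure ((M.E \ {e}) \ A)) :
    ThmN.RLS M p 9 :=
  rls_of_upward_key_two M p 9 319 639 (fun X hX h => ThmN.ncard_le_three_nineteen_of_eRk_le_nine_of_free M hfree X hX (by simpa using h)) (fun X hX h => by have := ThmN.ncard_le_two_mul_add_one_of_free M hfree (k := 9) (B := 319) (fun Y hY hrY => ThmN.ncard_le_three_nineteen_of_eRk_le_nine_of_free M hfree Y hY (by exact_mod_cast hrY)) X hX (by exact_mod_cast h); omega) hqp (by omega) hF'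
    (by push_cast; linarith [hkey])


end HypKey

end PercRepro
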